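import Summits.AnomalousDissipation.AnomalousDissipation.Theorems.SolenoidalFractalHomogenisationLagrangianStepSidebandSkew
import Summits.AnomalousDissipation.AnomalousDissipation.Theorems.SolenoidalFractalHomogenisationLagrangianStepCellLawVSlowGraphLinearResponse
import Summits.AnomalousDissipation.AnomalousDissipation.Theorems.SolenoidalFractalHomogenisationPermissibleFractalCarrierTime
import Mathlib.Analysis.Normed.Module.FiniteDimension
import HarnessLib

/-!
# K1L_D `LagrangianRenormalisationStepDesign` (stmt-AnomalousDissipation-27980), `stub_cellLawV0_IS` V0 — brick T2 (existence part):
# the periodic linear response of the truncated `ξ = 0` sideband system EXISTS, so `Sideband.response` / `meanFeedback` / `psiStar` are the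
# intended objects (helper; `--supports stmt-AnomalousDissipation-27980`)

Summits-side helper file of route `SolenoidalFractalHomogenisation` (prover seat `ad-k1l-cellLawV-w1` g5; definition of record D26-3 =
`…LagrangianStepSidebandDefs`, dissipativity = `…LagrangianStepSidebandSkew`).  Everything proved; no definitions, no named facts, no sorry.

* §1 time dependence: `continuous_slotEnvelope`, `slotEnvelope_add_period`, `linkCoeff_add_period`; `continuous_source`, `continuous_gen` (in operator norm,
  via `continuous_clm_apply` and the componentwise formulas), `source_add_period`, `gen_add_period` (`P = W₁.period`).
* §2 **`exists_isPeriodicResponse`** — for `NearIso 𝔸 lo' hi'` with `lo' > 0` and `γ₁ > 0`, every truncation `R` and slot `j`: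
  `∃ N, IsPeriodicResponse W₁ 𝔸 γ₁ R j N`.  Proof: G7 `…CellLawVSlowGraphLinearResponse.linearGraph_periodic_on` (p665279) on `E = ℂ³`, `F = Space R` (real
  finite-dimensional inner-product spaces) with `A₂₂ = gen` (dissipative with rate `min(γ₁, 4π²lo')` by `real_inner_gen_le`), `A₂₁ = ε • sourceⱼ` for a small
  `ε > 0` meeting G7's Riccati-inherited side condition `8δ² ≤ γ²` (the source is bounded on the compact period by continuity), one period `T = P`; the
  equation being LINEAR, `N := ε⁻¹ • N_ε` is a periodic response for the unit source.
* §3 `isPeriodicResponse_response_of_nearIso` — hence `Sideband.response` IS a periodic response under these hypotheses, in particular for the data of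
  `psiStar` (`𝔸 = ν•S`, `S` in a window `NearIso S lo hi` with `lo > 0`, `ν > 0`, `γ₁ = 1`): `isPeriodicResponse_response_psiStar`.
Uniqueness and the quantitative (`R`-uniform, weighted) bounds are the remaining part of T2.  NOT a proof of any registered stub, of the crux, or of anomalous
dissipation; rung F-D1.A0 infrastructure.
-/

set_option linter.dupNamespace false

noncomputable section

namespace Summit.AnomalousDissipation.AnomalousDissipation.Theorems.SolenoidalFractalHomogenisation.LagrangianStep.Sideband

open Set MeasureTheory Complex UnitAddTorus Filter Topology
open scoped InnerProductSpace
open Literature.Analysis Literature.Analysis.FunctionSpaces Literature.Analysis.FunctionSpaces.Torus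
open Literature.Analysis.FluidPDE Literature.Analysis.FluidPDE.Torus Literature.Analysis.FluidPDE.LatticeShear
open Summit.AnomalousDissipation.AnomalousDissipation.Theorems.SolenoidalFractalHomogenisation.LagrangianStep.CellChain (linkCoeff linkCoeff_def continuous_linkCoeff)
open Summit.AnomalousDissipation.AnomalousDissipation.Theorems.SolenoidalFractalHomogenisation.PermissibleCarrier (period_pos continuous_trapezoid_fract)

variable {k₀ : ℕ}

/-! ## §1 Time dependence of the coefficients: continuity and periodicity -/

/-- The slot envelope is continuous in time. [cite: ArmstrongVicol2025, §4 p. 17 (time cutoff)] -/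
theorem continuous_slotEnvelope (W₁ : LatticeWord k₀) (j : Fin k₀) : Continuous (slotEnvelope W₁ j) := by
  have h := continuous_trapezoid_fract W₁ j 1
  simp only [one_mul] at h
  exact h

/-- The slot envelope is `P`-periodic. [cite: ArmstrongVicol2025, §4 p. 17 (time cutoff)] -/
theorem slotEnvelope_add_period (W₁ : LatticeWord k₀) (j : Fin k₀) (t : ℝ) : slotEnvelope W₁ j (t + W₁.period) = slotEnvelope W₁ j t := by
  have hp : W₁.period ≠ 0 := (period_pos W₁).ne'
  simp only [slotEnvelope_def, add_div, div_self hp, Int.fract_add_one]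

/-- The link coefficient is `P`-periodic. [cite: MeshalkinSinai1961, pp. 1700–1705] -/
theorem linkCoeff_add_period (W₁ : LatticeWord k₀) (n : ℕ) (k : Fin 3 → ℤ) (j : Fin k₀) (t : ℝ) :
    linkCoeff W₁ n k j (t + W₁.period) = linkCoeff W₁ n k j t := by
  rw [linkCoeff_eq, linkCoeff_eq, slotEnvelope_add_period]

/-- The unit source components are `P`-periodic. [cite: MajdaKramer1999, §2.2.1.3] -/
theorem sourceComp_add_period (W₁ : LatticeWord k₀) (R : ℕ) (j : Fin k₀) (t : ℝ) (z : box R) :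
    sourceComp W₁ R j (t + W₁.period) z = sourceComp W₁ R j t z := by
  rw [sourceComp, sourceComp, slotEnvelope_add_period]

/-- The unit source is `P`-periodic. [cite: MajdaKramer1999, §2.2.1.3] -/
theorem source_add_period (W₁ : LatticeWord k₀) (R : ℕ) (j : Fin k₀) (t : ℝ) : source W₁ R j (t + W₁.period) = source W₁ R j t := by
  unfold source
  congr 2
  funext z
  exact sourceComp_add_period W₁ R j t z

/-- The generator components are `P`-periodic. [cite: MajdaKramer1999, §2.2.1.3] -/
theorem genComp_add_period (W₁ : LatticeWord k₀) (𝔸 : Torus.Visc4 (Fin 3)) (γ₁ : ℝ) (R : ℕ) (t : ℝ) (z : box R) :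
    genComp W₁ 𝔸 γ₁ R (t + W₁.period) z = genComp W₁ 𝔸 γ₁ R t z := by
  rw [genComp, genComp]
  congr 1
  exact Finset.sum_congr rfl fun j _ => by rw [linkCoeff_add_period]

/-- The generator is `P`-periodic. [cite: MajdaKramer1999, §2.2.1.3] -/
theorem gen_add_period (W₁ : LatticeWord k₀) (𝔸 : Torus.Visc4 (Fin 3)) (γ₁ : ℝ) (R : ℕ) (t : ℝ) :
    gen W₁ 𝔸 γ₁ R (t + W₁.period) = gen W₁ 𝔸 γ₁ R t := by
  unfold gen
  congr 2
  funext z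
  exact genComp_add_period W₁ 𝔸 γ₁ R t z

/-- The unit source is continuous in time (operator norm). [cite: MajdaKramer1999, §2.2.1.3] -/
theorem continuous_source (W₁ : LatticeWord k₀) (R : ℕ) (j : Fin k₀) : Continuous fun t => source W₁ R j t := by
  rw [continuous_clm_apply]
  intro v
  have hc : Continuous fun t => (PiLp.continuousLinearEquiv 2 ℂ (fun _ : box R => EuclideanSpace ℂ (Fin 3))).symm
      (fun z : box R => sourceComp W₁ R j t z v) := by
    refine (PiLp.continuousLinearEquiv 2 ℂ (fun _ : box R => EuclideanSpace ℂ (Fin 3))).symm.continuous.comp ?_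
    refine continuous_pi fun z => ?_
    have he := (Complex.continuous_ofReal.comp (continuous_slotEnvelope W₁ j))
    simp only [sourceComp]
    refine Continuous.add ?_ ?_
    · split_ifs
      · exact ((((continuous_const.mul he).mul continuous_const).neg).smul continuous_const)
      · exact continuous_const
    · split_ifs
      · exact ((((continuous_const.mul he).mul continuous_const).neg).smul continuous_const)
      · exact continuous_const
  refine hc.congr fun t => ?_
  simp [source]

/-- The generator is continuous in time (operator norm). [cite: MajdaKramer1999, §2.2.1.3] -/
theorem continuous_gen (W₁ : LatticeWord k₀) (𝔸 : Torus.Visc4 (Fin 3)) (γ₁ : ℝ) (R : ℕ) : Continuous fun t => gen W₁ 𝔸 γ₁ R t := by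
  rw [continuous_clm_apply]
  intro y
  have hc : Continuous fun t => (PiLp.continuousLinearEquiv 2 ℂ (fun _ : box R => EuclideanSpace ℂ (Fin 3))).symm
      (fun z : box R => genComp W₁ 𝔸 γ₁ R t z y) := by
    refine (PiLp.continuousLinearEquiv 2 ℂ (fun _ : box R => EuclideanSpace ℂ (Fin 3))).symm.continuous.comp ?_
    refine continuous_pi fun z => ?_
    have h : (fun t => genComp W₁ 𝔸 γ₁ R t z y) = fun t =>
        -((((4 * Real.pi ^ 2 : ℝ) : ℂ)) • transversalProj z.1 (Torus.symbT (Torus.majorTranspose 𝔸) z.1 (transversalProj z.1 (coordL R z.1 y)))) -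
        ((γ₁ : ℝ) : ℂ) • (coordL R z.1 y - transversalProj z.1 (coordL R z.1 y)) -
        ∑ j, linkCoeff W₁ 1 z.1 j t • transversalProj z.1
          (slotAmp W₁ j • transversalProj (z.1 - (W₁.phase j).m) (coordL R (z.1 - (W₁.phase j).m) y) +
            starRingEnd ℂ (slotAmp W₁ j) • transversalProj (z.1 + (W₁.phase j).m) (coordL R (z.1 + (W₁.phase j).m) y)) :=
      funext fun t => genComp_apply W₁ 𝔸 γ₁ R t z y
    rw [h]
    refine (continuous_const.sub ?_)
    exact continuous_finsetSum _ fun j _ => (continuous_linkCoeff W₁ 1 z.1 j).smul continuous_const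
  refine hc.congr fun t => ?_
  simp [gen]

/-! ## §2 Existence of the periodic linear response -/

/-- **THE PERIODIC LINEAR RESPONSE EXISTS**: for `NearIso 𝔸 lo' hi'` with `lo' > 0` and a longitudinal damping `γ₁ > 0`, every truncation `R` and every
slot `j` admit a periodic response `N` (`IsPeriodicResponse W₁ 𝔸 γ₁ R j N`).  [cite: SandersVerhulstMurdock2007, Lemma 5.2.7 (linear case)]
[cite: MajdaKramer1999, §2.2.1.3 (cell problem (49))] -/
theorem exists_isPeriodicResponse (W₁ : LatticeWord k₀) {𝔸 : Torus.Visc4 (Fin 3)} {lo' hi' : ℝ} (h𝔸 : Torus.NearIso 𝔸 lo' hi') (hlo' : 0 < lo')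
    {γ₁ : ℝ} (hγ₁ : 0 < γ₁) (R : ℕ) (j : Fin k₀) : ∃ N, IsPeriodicResponse W₁ 𝔸 γ₁ R j N := by
  have hP : 0 < W₁.period := period_pos W₁
  set γ : ℝ := min γ₁ (4 * Real.pi ^ 2 * lo') with hγdef
  have hγ : 0 < γ := lt_min hγ₁ (by positivity)
  -- a bound for the source on the period
  obtain ⟨δ₀, hδ₀⟩ := (isCompact_Icc (a := (0:ℝ)) (b := W₁.period)).exists_bound_of_continuousOn (continuous_source W₁ R j).continuousOn
  set δ₁ : ℝ := max δ₀ 0 with hδ₁def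
  have hδ₁ : 0 ≤ δ₁ := le_max_right _ _
  have hδ₀₁ : ∀ t ∈ Icc (0:ℝ) W₁.period, ‖source W₁ R j t‖ ≤ δ₁ := fun t ht => (hδ₀ t ht).trans (le_max_left _ _)
  -- the scaling
  set ε : ℝ := γ / (4 * (δ₁ + 1)) with hεdef
  have hε : 0 < ε := by positivity
  set δ : ℝ := ε * δ₁ with hδdef
  have hδ : 0 ≤ δ := by positivity
  have hδγ : δ ≤ γ / 4 := by
    rw [hδdef, hεdef, div_mul_eq_mul_div, div_le_div_iff₀ (by positivity) (by norm_num)]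
    nlinarith [hγ.le, hδ₁]
  have h8 : 8 * δ ^ 2 ≤ γ ^ 2 := by nlinarith [hδγ, hδ, hγ.le]
  -- G7
  obtain ⟨Nε, hc, hd, -, hp⟩ := SlowGraph.linearGraph_periodic_on (EuclideanSpace ℂ (Fin 3)) (Space R)
    (fun t => ε • (source W₁ R j t).restrictScalars ℝ) (fun t => (gen W₁ 𝔸 γ₁ R t).restrictScalars ℝ) γ δ W₁.period W₁.period hδ hγ h8 hP le_rfl
    (fun t _ z => by
      rw [ContinuousLinearMap.coe_restrictScalars']
      exact real_inner_gen_le W₁ h𝔸 hlo'.le γ₁ R t z)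
    (fun t ht => by
      rw [norm_smul, Real.norm_of_nonneg hε.le, ContinuousLinearMap.norm_restrictScalars]
      exact mul_le_mul_of_nonneg_left (hδ₀₁ t ht) hε.le)
    (by
      rw [continuousOn_clm_apply]
      intro v
      have h := ((continuous_clm_apply.1 (continuous_source W₁ R j)) v).const_smul ε
      exact h.continuousOn.congr fun t _ => by simp)
    (by
      rw [continuousOn_clm_apply]
      intro v
      have h := (continuous_clm_apply.1 (continuous_gen W₁ 𝔸 γ₁ R)) v
      exact h.continuousOn.congr fun t _ => by simp)
    (fun t _ _ => by rw [source_add_period])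
    (fun t _ _ => by rw [gen_add_period])
  -- rescale
  have hper : Nε W₁.period = Nε 0 := by
    have h := hp 0 le_rfl (by rw [zero_add])
    rwa [zero_add] at h
  refine ⟨fun t => ε⁻¹ • Nε t, hc.const_smul ε⁻¹, fun t ht => ?_, by simp only [hper]⟩
  have h := (hd t ht).const_smul ε⁻¹
  refine h.congr_deriv ?_
  rw [smul_add, smul_smul, inv_mul_cancel₀ hε.ne', one_smul, ContinuousLinearMap.comp_smul]

/-! ## §3 `Sideband.response` is a periodic response -/

/-- Under the hypotheses of `exists_isPeriodicResponse`, the chosen `Sideband.response` is a periodic response. [cite: SandersVerhulstMurdock2007, Lemma 5.2.7 (linear case)] -/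
theorem isPeriodicResponse_response_of_nearIso (W₁ : LatticeWord k₀) {𝔸 : Torus.Visc4 (Fin 3)} {lo' hi' : ℝ} (h𝔸 : Torus.NearIso 𝔸 lo' hi')
    (hlo' : 0 < lo') {γ₁ : ℝ} (hγ₁ : 0 < γ₁) (R : ℕ) (j : Fin k₀) :
    IsPeriodicResponse W₁ 𝔸 γ₁ R j (response W₁ 𝔸 γ₁ R j) :=
  isPeriodicResponse_response (exists_isPeriodicResponse W₁ h𝔸 hlo' hγ₁ R j)

/-- **The data of `psiStar` admit the periodic response**: for `ν > 0` and a background shape `S` in a window `NearIso S lo hi` with `lo > 0`, the response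
used in `psiStar W M hM ν S` (`W₁ = (W.stretch M).stretch (1/ν)`, `𝔸 = ν•S`, `γ₁ = 1`, `R = R0 ν`) is a periodic response for every slot.
[cite: SandersVerhulstMurdock2007, Lemma 5.2.7 (linear case)] [cite: MajdaKramer1999, §2.2.1.3] -/
theorem isPeriodicResponse_response_psiStar (W : LatticeWord k₀) (M : ℝ) (hM : 0 < M) {ν : ℝ} (hν : 0 < ν) {S : Torus.Visc4 (Fin 3)}
    {lo hi : ℝ} (hS : Torus.NearIso S lo hi) (hlo : 0 < lo) (j : Fin k₀) :
    IsPeriodicResponse ((W.stretch M hM).stretch (1 / ν) (one_div_pos.mpr hν)) (ν • S) 1 (R0 ν) j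
      (response ((W.stretch M hM).stretch (1 / ν) (one_div_pos.mpr hν)) (ν • S) 1 (R0 ν) j) :=
  isPeriodicResponse_response_of_nearIso _ (hS.smul hν.le) (mul_pos hν hlo) one_pos _ j

end Summit.AnomalousDissipation.AnomalousDissipation.Theorems.SolenoidalFractalHomogenisation.LagrangianStep.Sideband

end
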